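import Mathlib
import Summits.AtomisticToContinuum.HydrodynamicLimit.Theorems.ImplosionDichotomyDenseExcursionPackingAnalyticDerivRecoveryPointwise
import Summits.AtomisticToContinuum.HydrodynamicLimit.Theorems.ImplosionDichotomyDenseExcursionPackingAnalyticDerivRecoveryCore

/-!
# `C¹` recovery off the sonic window for the packing hierarchy: the far field by limits, and the assembly
# (crux `DenseExcursion`, stmt-AtomisticToContinuum-12586, line `sonic-cavity-renewal` v7, stub `stub_analyticPackingImplosion`)

Helper file (`--supports stmt-AtomisticToContinuum-12586`, line lead a2, wave-3 worker D, task `derivRecovery_offSonic`).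
THE ONLY PLACE WHERE THE LAPLACE GAIN `1/k` OF `PackingResolvent` IS CONSUMED (W6 report §4): off the sonic window
`|x| ≥ ρ₁` the first `x`-derivatives of a solution of `(kμ − L)X = Src` are recovered ALGEBRAICALLY from the first-order
system, at the cost of one power of `kμ` in the weighted `C⁰` norm and with no loss otherwise. Kernel-checked here:

* `bdd_Ici_of_tendsto`: a function continuous on `[1, ∞)` with a finite limit at `+∞` is bounded there;
* `far_envelope`: for a monatomic profile whose only sonic crossing on `x > 0` is excluded (`W + S < 1` there — clause
  (a) of `CavityTube`), the quantities `|W|, |W′|, |S′/S|, |S(S′+S)|` are bounded and `1 + S² ≤ K Δ` on `x ≥ 1`, with SOME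
  constants: `Δ = (1 − W)² − S² > 0` there and, by the profile ODE `ΔW′ = −Δ₁`, `ΔS′ = −Δ₂` and the far-field limits
  `W, S → 0` of `IsMonatomicProfile`, `W′ → 0`, `S′/S → −r`, `S(S′ + S) → 0`, `Δ → 1` — NO far-field DATA is needed for
  an existential constant (a certified envelope, validated numerically in the worker's report, would only make it explicit);
* `resolventEqs_real`: the coerced complex form of the equations (as in `PackingResolvent`) gives the real form;
* `derivRecovery_offSonic` (REGISTERED helper): for `0 < ρ₁ ≤ 1`, a monatomic cavity-tube profile admits ONE constant `C`
  such that every real solution of the two resolvent equations at a point `|x| ≥ ρ₁` (any real `Λ`) satisfies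
  `|u₁′| + (1 + S²)|(u₂/S)′| ≤ C((|Λ| + 1)(|u₁| + |u₂|/S) + |f₁| + |f₂|/S)` — `core_envelope` on `x ≤ 1`, `far_envelope` on
  `x ≥ 1`, `derivRecovery_pointwise` at the point.

NOT here: the sonic window `|x| < ρ₁` (the `N_θ` scale, W6 report §4), norms, or `Γ`.
-/

noncomputable section

open Set Filter Topology

namespace Summit.AtomisticToContinuum.HydrodynamicLimit.Theorems.PackingAnalyticImplosion

open Summit.AtomisticToContinuum.HydrodynamicLimit.Theorems.R2OneModeTwoConditions
open Summit.AtomisticToContinuum.HydrodynamicLimit.Theorems.SonicCavityRenewal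

/-! ## Bounded from continuous with a limit -/

/-- A real function continuous on `[1, ∞)` with a finite limit at `+∞` is bounded on `[1, ∞)`. [folklore] -/
theorem bdd_Ici_of_tendsto {g : ℝ → ℝ} {l : ℝ} (hc : ContinuousOn g (Ici 1)) (ht : Tendsto g atTop (𝓝 l)) :
    ∃ B : ℝ, ∀ x, 1 ≤ x → |g x| ≤ B := by
  obtain ⟨X, hX⟩ := (Metric.tendsto_atTop.mp ht) 1 one_pos
  obtain ⟨B₁, hB₁⟩ := (isCompact_Icc (a := (1:ℝ)) (b := max X 1)).exists_bound_of_continuousOn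
    (hc.mono Icc_subset_Ici_self)
  refine ⟨max B₁ (|l| + 1), fun x hx => ?_⟩
  rcases le_or_gt x (max X 1) with hxX | hxX
  · have h := hB₁ x ⟨hx, hxX⟩
    rw [Real.norm_eq_abs] at h
    exact h.trans (le_max_left _ _)
  · have hxX' : X ≤ x := (le_max_left _ _).trans hxX.le
    have h := hX x hxX'
    rw [Real.dist_eq] at h
    calc |g x| = |(g x - l) + l| := by ring_nf
      _ ≤ |g x - l| + |l| := abs_add_le _ _
      _ ≤ |l| + 1 := by linarith
      _ ≤ max B₁ (|l| + 1) := le_max_right _ _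

/-! ## The far field by limits -/

/-- **THE FAR-FIELD ENVELOPE BY LIMITS**: for a monatomic profile with `W + S < 1` on `x > 0`, there are constants `A, K`
with `|W|, |W′|, |S′/S|, |S(S′+S)| ≤ A` and `1 + S² ≤ K|(W−1)² − S²|` for all `x ≥ 1`. [folklore] -/
theorem far_envelope {r : ℝ} {W S : ℝ → ℝ} (hP : IsMonatomicProfile r W S) (hsub : ∀ x, 0 < x → W x + S x < 1) :
    ∃ A K : ℝ, ∀ x, 1 ≤ x → |W x| ≤ A ∧ |deriv W x| ≤ A ∧ |deriv S x / S x| ≤ A ∧ |S x * (deriv S x + S x)| ≤ A ∧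
      1 + S x ^ 2 ≤ K * |(W x - 1) ^ 2 - S x ^ 2| := by
  obtain ⟨-, -, hWs, hSs, hSpos, hode, -, hWlim, hSlim⟩ := hP
  have hWc : Continuous W := hWs.continuous
  have hSc : Continuous S := hSs.continuous
  have hW'c : Continuous (deriv W) := (contDiff_infty_iff_deriv.1 hWs).2.continuous
  have hS'c : Continuous (deriv S) := (contDiff_infty_iff_deriv.1 hSs).2.continuous
  -- `Δ > 0` on `x > 0`
  have hΔpos : ∀ x, 0 < x → 0 < Delta (S x) (W x) := by
    intro x hx
    have h1 := hsub x hx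
    have h2 := hSpos x
    have e : Delta (S x) (W x) = (1 - W x - S x) * (1 - W x + S x) := by unfold Delta; ring
    rw [e]; exact mul_pos (by linarith) (by linarith)
  -- the ODE solved for the derivatives on `x > 0`
  have hW' : ∀ x, 0 < x → deriv W x = -Delta1 r (S x) (W x) / Delta (S x) (W x) := by
    intro x hx
    have h := (hode x).1
    rw [mul_comm] at h
    exact eq_div_of_mul_eq (hΔpos x hx).ne' h
  have hσ : ∀ x, 0 < x → deriv S x / S x =
      -(5 * W x ^ 2 - (6 + 2 * r) * W x + 3 * r - 3 * S x ^ 2) / (3 * Delta (S x) (W x)) := by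
    intro x hx
    have h := (hode x).2
    have hS0 : S x ≠ 0 := (hSpos x).ne'
    have hΔ0 : Delta (S x) (W x) ≠ 0 := (hΔpos x hx).ne'
    rw [div_eq_div_iff hS0 (mul_ne_zero three_ne_zero hΔ0)]
    unfold Delta2 at h
    linear_combination 3 * h
  -- limits at `+∞`
  have hPt : Tendsto (fun x => (S x, W x)) atTop (𝓝 ((0 : ℝ), (0 : ℝ))) := hSlim.prodMk_nhds hWlim
  have hW't : Tendsto (deriv W) atTop (𝓝 0) := by
    have hF : ContinuousAt (fun p : ℝ × ℝ => -Delta1 r p.1 p.2 / Delta p.1 p.2) ((0 : ℝ), (0 : ℝ)) := by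
      unfold Delta Delta1
      exact ContinuousAt.div (by fun_prop) (by fun_prop) (by norm_num)
    have h := hF.tendsto.comp hPt
    have h0 : (fun p : ℝ × ℝ => -Delta1 r p.1 p.2 / Delta p.1 p.2) ((0 : ℝ), (0 : ℝ)) = 0 := by
      simp [Delta, Delta1]
    have h1 : Tendsto ((fun p : ℝ × ℝ => -Delta1 r p.1 p.2 / Delta p.1 p.2) ∘ fun x => (S x, W x)) atTop (𝓝 0) := by
      convert h using 2
      exact h0.symm
    refine h1.congr' ?_
    filter_upwards [eventually_gt_atTop 0] with x hx
    simp only [Function.comp_apply]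
    exact (hW' x hx).symm
  have hσt : Tendsto (fun x => deriv S x / S x) atTop (𝓝 (-r)) := by
    have hF : ContinuousAt (fun p : ℝ × ℝ => -(5 * p.2 ^ 2 - (6 + 2 * r) * p.2 + 3 * r - 3 * p.1 ^ 2) /
        (3 * Delta p.1 p.2)) ((0 : ℝ), (0 : ℝ)) := by
      unfold Delta
      exact ContinuousAt.div (by fun_prop) (by fun_prop) (by norm_num)
    have h := hF.tendsto.comp hPt
    have h0 : (fun p : ℝ × ℝ => -(5 * p.2 ^ 2 - (6 + 2 * r) * p.2 + 3 * r - 3 * p.1 ^ 2) /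
        (3 * Delta p.1 p.2)) ((0 : ℝ), (0 : ℝ)) = -r := by
      simp [Delta]; ring
    have h1 : Tendsto ((fun p : ℝ × ℝ => -(5 * p.2 ^ 2 - (6 + 2 * r) * p.2 + 3 * r - 3 * p.1 ^ 2) /
        (3 * Delta p.1 p.2)) ∘ fun x => (S x, W x)) atTop (𝓝 (-r)) := by
      convert h using 2
      exact h0.symm
    refine h1.congr' ?_
    filter_upwards [eventually_gt_atTop 0] with x hx
    simp only [Function.comp_apply]
    exact (hσ x hx).symm
  have hS't : Tendsto (deriv S) atTop (𝓝 0) := by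
    have h := hσt.mul hSlim
    rw [mul_zero] at h
    refine h.congr' (Eventually.of_forall fun x => ?_)
    exact div_mul_cancel₀ _ (hSpos x).ne'
  have hπt : Tendsto (fun x => S x * (deriv S x + S x)) atTop (𝓝 0) := by
    have h := hSlim.mul (hS't.add hSlim)
    simpa using h
  have hΔt : Tendsto (fun x => (Delta (S x) (W x))⁻¹) atTop (𝓝 1) := by
    have hF : ContinuousAt (fun p : ℝ × ℝ => Delta p.1 p.2) ((0 : ℝ), (0 : ℝ)) := by
      unfold Delta; fun_prop
    have h := hF.tendsto.comp hPt
    have h0 : (fun p : ℝ × ℝ => Delta p.1 p.2) ((0 : ℝ), (0 : ℝ)) = 1 := by simp [Delta]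
    have h1 : Tendsto ((fun p : ℝ × ℝ => Delta p.1 p.2) ∘ fun x => (S x, W x)) atTop (𝓝 1) := by
      convert h using 2
      exact h0.symm
    have h2 := h1.inv₀ one_ne_zero
    rw [inv_one] at h2
    exact h2
  -- boundedness on `[1, ∞)`
  obtain ⟨BW, hBW⟩ := bdd_Ici_of_tendsto hWc.continuousOn hWlim
  obtain ⟨BW', hBW'⟩ := bdd_Ici_of_tendsto hW'c.continuousOn hW't
  obtain ⟨Bσ, hBσ⟩ := bdd_Ici_of_tendsto
    ((hS'c.continuousOn.div hSc.continuousOn fun x _ => (hSpos x).ne') : ContinuousOn (fun x => deriv S x / S x) (Ici 1))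
    hσt
  obtain ⟨Bπ, hBπ⟩ := bdd_Ici_of_tendsto
    ((hSc.continuousOn.mul (hS'c.continuousOn.add hSc.continuousOn)) :
      ContinuousOn (fun x => S x * (deriv S x + S x)) (Ici 1)) hπt
  obtain ⟨BS, hBS⟩ := bdd_Ici_of_tendsto hSc.continuousOn hSlim
  have hΔc : ContinuousOn (fun x => (Delta (S x) (W x))⁻¹) (Ici 1) := by
    have h1 : Continuous fun x => Delta (S x) (W x) := by unfold Delta; fun_prop
    exact h1.continuousOn.inv₀ fun x hx => (hΔpos x (by simp only [mem_Ici] at hx; linarith)).ne'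
  obtain ⟨BΔ, hBΔ⟩ := bdd_Ici_of_tendsto hΔc hΔt
  refine ⟨max (max BW BW') (max Bσ Bπ), (1 + BS ^ 2) * BΔ, fun x hx => ⟨?_, ?_, ?_, ?_, ?_⟩⟩
  · exact (hBW x hx).trans ((le_max_left _ _).trans (le_max_left _ _))
  · exact (hBW' x hx).trans ((le_max_right _ _).trans (le_max_left _ _))
  · exact (hBσ x hx).trans ((le_max_left _ _).trans (le_max_right _ _))
  · exact (hBπ x hx).trans ((le_max_right _ _).trans (le_max_right _ _))
  · have hx0 : 0 < x := by linarith
    have hΔ := hΔpos x hx0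
    have e : (W x - 1) ^ 2 - S x ^ 2 = Delta (S x) (W x) := by unfold Delta; ring
    rw [e, abs_of_pos hΔ]
    have h1 : S x ^ 2 ≤ BS ^ 2 := by
      have := hBS x hx
      exact sq_le_sq.mpr (this.trans (le_abs_self _))
    have h2 : 1 ≤ BΔ * Delta (S x) (W x) := by
      have := hBΔ x hx
      rw [abs_of_pos (inv_pos.2 hΔ)] at this
      rw [inv_le_iff_one_le_mul₀ hΔ] at this
      linarith
    have h3 : 0 ≤ 1 + BS ^ 2 := by positivity
    calc 1 + S x ^ 2 ≤ (1 + BS ^ 2) * 1 := by linarith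
      _ ≤ (1 + BS ^ 2) * (BΔ * Delta (S x) (W x)) := mul_le_mul_of_nonneg_left h2 h3
      _ = (1 + BS ^ 2) * BΔ * Delta (S x) (W x) := by ring

/-! ## From the coerced (complex) form of `PackingResolvent` to the real equations -/

/-- REAL FORM OF THE RESOLVENT EQUATIONS: if real `u₁, u₂` (differentiable) satisfy the two equations of
`PackingResolvent`/`LargeRealResolvent` — stated through the complex vocabulary `linW`, `linS` by coercion — then they
satisfy the two REAL equations consumed by `derivRecovery_offSonic`. [folklore] -/
theorem resolventEqs_real {r Λ : ℝ} {W S u₁ u₂ f₁ f₂ : ℝ → ℝ} (hu₁ : Differentiable ℝ u₁) (hu₂ : Differentiable ℝ u₂)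
    (h : ∀ x, ((Λ : ℝ) : ℂ) * (u₁ x : ℂ) - linW r W S (fun y => (u₁ y : ℂ)) (fun y => (u₂ y : ℂ)) x = (f₁ x : ℂ) ∧
      ((Λ : ℝ) : ℂ) * (u₂ x : ℂ) - linS r W S (fun y => (u₁ y : ℂ)) (fun y => (u₂ y : ℂ)) x = (f₂ x : ℂ)) (x : ℝ) :
    Λ * u₁ x - ((W x - 1) * deriv u₁ x + 3 * S x * deriv u₂ x + (deriv W x + 2 * W x - r) * u₁ x +
        (3 * deriv S x + 6 * S x) * u₂ x) = f₁ x ∧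
      Λ * u₂ x - (S x / 3 * deriv u₁ x + (W x - 1) * deriv u₂ x + (deriv S x + 2 * S x) * u₁ x +
        (deriv W x / 3 + 2 * W x - r) * u₂ x) = f₂ x := by
  obtain ⟨h1, h2⟩ := h x
  have d1 : deriv (fun y => (u₁ y : ℂ)) x = ((deriv u₁ x : ℝ) : ℂ) := ((hu₁ x).hasDerivAt.ofReal_comp).deriv
  have d2 : deriv (fun y => (u₂ y : ℂ)) x = ((deriv u₂ x : ℝ) : ℂ) := ((hu₂ x).hasDerivAt.ofReal_comp).deriv
  unfold linW at h1
  unfold linS at h2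
  rw [d1, d2] at h1 h2
  beta_reduce at h1 h2
  constructor
  · exact_mod_cast h1
  · exact_mod_cast h2

/-! ## The assembly -/

/-- **`C¹` RECOVERY OFF THE SONIC WINDOW** (registered helper `derivRecovery_offSonic` of
`stub_analyticPackingImplosion`): for `0 < ρ₁ ≤ 1` and a monatomic cavity-tube profile there is ONE constant `C` such
that, at every point `|x| ≥ ρ₁` and for every real `Λ`, every real solution of the two resolvent equations
`Λu − Lu = f` (`L = (linW, linS)`, real form) satisfies
`|u₁′| + (1 + S²)|(u₂/S)′| ≤ C((|Λ| + 1)(|u₁| + |u₂|/S) + |f₁| + |f₂|/S)`. [folklore] -/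
theorem derivRecovery_offSonic : ∀ (r : ℝ) (W S : ℝ → ℝ) (ρ₁ : ℝ), 0 < ρ₁ → ρ₁ ≤ 1 → IsMonatomicProfile r W S → CavityTube r W S → ∃ C : ℝ, 0 < C ∧ ∀ (Λ : ℝ) (u₁ u₂ f₁ f₂ : ℝ → ℝ) (x : ℝ), ρ₁ ≤ |x| → DifferentiableAt ℝ u₂ x → Λ * u₁ x - ((W x - 1) * deriv u₁ x + 3 * S x * deriv u₂ x + (deriv W x + 2 * W x - r) * u₁ x + (3 * deriv S x + 6 * S x) * u₂ x) = f₁ x → Λ * u₂ x - (S x / 3 * deriv u₁ x + (W x - 1) * deriv u₂ x + (deriv S x + 2 * S x) * u₁ x + (deriv W x / 3 + 2 * W x - r) * u₂ x) = f₂ x → |deriv u₁ x| + (1 + S x ^ 2) * |deriv (fun y => u₂ y / S y) x| ≤ C * ((|Λ| + 1) * (|u₁ x| + |u₂ x| / S x) + (|f₁ x| + |f₂ x| / S x)) := by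
  intro r W S ρ₁ hρ₁ hρ₁1 hP hT
  have hr : 0 ≤ r := by linarith [hP.1]
  have hSpos : ∀ x, 0 < S x := hP.2.2.2.2.1
  have hSd : Differentiable ℝ S := hP.2.2.2.1.differentiable (by simp)
  have hsub : ∀ x, 0 < x → W x + S x < 1 := hT.2.2.1
  obtain ⟨A₂, K₂, hfar⟩ := far_envelope hP hsub
  -- common constants
  set A : ℝ := max 3 A₂ with hAdef
  set K : ℝ := max (40 / ρ₁) K₂ with hKdef
  have hA3 : 3 ≤ A := le_max_left _ _
  have hK40 : 40 / ρ₁ ≤ K := le_max_left _ _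
  have hKpos : 0 < K := lt_of_lt_of_le (by positivity) hK40
  have henv : ∀ x, ρ₁ ≤ |x| → |W x| ≤ A ∧ |deriv W x| ≤ A ∧ |deriv S x / S x| ≤ A ∧
      |S x * (deriv S x + S x)| ≤ A ∧ 1 + S x ^ 2 ≤ K * |(W x - 1) ^ 2 - S x ^ 2| := by
    intro x hx
    rcases le_or_gt x 1 with hx1 | hx1
    · obtain ⟨h1, h2, h3, h4, h5⟩ := core_envelope r W S ρ₁ hρ₁ hρ₁1 hSpos hSd hT x hx1 hx
      exact ⟨h1.trans hA3, h2.trans hA3, h3.trans hA3, h4.trans hA3,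
        h5.trans (mul_le_mul_of_nonneg_right hK40 (abs_nonneg _))⟩
    · obtain ⟨h1, h2, h3, h4, h5⟩ := hfar x hx1.le
      exact ⟨h1.trans (le_max_right _ _), h2.trans (le_max_right _ _), h3.trans (le_max_right _ _),
        h4.trans (le_max_right _ _), h5.trans (mul_le_mul_of_nonneg_right (le_max_right _ _) (abs_nonneg _))⟩
  have hCpos : 0 < (2 * A + 6) * K * (A ^ 2 + 10 * A + r + 3) :=
    mul_pos (mul_pos (by linarith) hKpos) (by nlinarith)
  refine ⟨(2 * A + 6) * K * (A ^ 2 + 10 * A + r + 3), hCpos, ?_⟩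
  intro Λ u₁ u₂ f₁ f₂ x hx hu₂ h1 h2
  obtain ⟨eW, eW', eσ, eπ, eK⟩ := henv x hx
  have hS := hSpos x
  -- the derivative of the quotient
  have hq : deriv (fun y => u₂ y / S y) x = (deriv u₂ x * S x - u₂ x * deriv S x) / S x ^ 2 :=
    (hu₂.hasDerivAt.div (hSd x).hasDerivAt hS.ne').deriv
  rw [hq]
  exact derivRecovery_pointwise r (W x) (deriv W x) (S x) (deriv S x) Λ (u₁ x) (deriv u₁ x) (u₂ x) (deriv u₂ x)
    (f₁ x) (f₂ x) A K hS hr eW eW' eσ eπ eK h1 h2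

end Summit.AtomisticToContinuum.HydrodynamicLimit.Theorems.PackingAnalyticImplosion

end
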